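import Summits.BirchSwinnertonDyer.Rank1Residual.Additive.ChiEigenPrimeToPDescentGenerator
import Summits.BirchSwinnertonDyer.Rank1Residual.Additive.ChiBranchInputBigImageEven
import Summits.BirchSwinnertonDyer.Rank1Residual.Additive.ChiBranchInputBigImage
import Summits.BirchSwinnertonDyer.Rank1Residual.Additive.ChiBranchConstantTermOdd
import Summits.BirchSwinnertonDyer.Rank1Residual.Additive.CyclotomicQuadraticSubfield
import Summits.BirchSwinnertonDyer.Rank1Residual.AdditivePotMult.TwistSupplyJ
import Summits.BirchSwinnertonDyer.Rank1Residual.EisensteinPrimes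
import Literature.NumberTheory.EllipticCurves.Kato2004.BigImageDivisibilityCyclotomicPrimeComponent
import HarnessLib

/-!
# Brick 5′ (big image): the typed `χ_p`-branch inputs `ChiBranchLeadingTerm[Odd]BigImageAt W p`
# are THEOREMS at every odd `p` for `W` potentially good at `p`, from the componentwise reading of
# Kato 2004 Thm. 17.4 (3) + the kernel transport [C] (cell `b2b-bsdres`, sub-cell additive-p2, gen 12)

HONEST FRAMING (cell `b2b-bsdres`, run/shared/lean/b2b/bsd-rank1-residual/, verbatim in every
file): the goal of the cell is to DELETE the COMBINATION-SHAPED residual classes of the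
Birch–Swinnerton-Dyer formula for ALL analytic-rank `≤ 1` elliptic curves over `ℚ` — "full BSD
formula for every rank `≤ 1` curve in class `C`" assembled STRICTLY from published theorems — so
that the rank-`≤ 1` remainder becomes exactly the CONSTRUCTION-SHAPED classes, which are TYPED
(missing-input `Prop`s), NOT attempted. This is not "finishing BSD". Sub-cell `additive-p2`
(CLASS-OWNERS row "X3/X4 additive — pot. good ordinary / X3♯(G-ord)"), generation 12: research
route; no claim beyond the stated classes; X3♯(G-ord)/X4♯(G-ord) stay CONSTRUCTION-SHAPED; labels /
census / located gap UNCHANGED; nothing is booked. Theorems only (no definition, no new named fact;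
ONE named fact enters as a HYPOTHESIS: `Kato2004.charIdeal_dvd_padicLFunctionBranch_component_of_surjective`,
the component `i = (p−1)/2` reading of Kato's Thm. 17.4 (3), file
`Literature/…/Kato2004/BigImageDivisibilityCyclotomicPrimeComponent.lean`).

WHAT. additive-p4's typed predicates `ChiBranchLeadingTermOddBigImageAt W p` (`p ≡ 3 (mod 4)`) and
`ChiBranchLeadingTermBigImageAt W p` (`p ≡ 1 (mod 4)`) — "[B∘C] at `T = 0` for the big-image twist"
— become theorems for every `W` with `0 ≤ ord_p j(W)` (potentially good at `p`; in particular on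
the whole (G)-cell, `TypeG W p`), GIVEN the component reading-fact:

  `chiBranchLeadingTermOddBigImageAt_of_katoComponent`, `chiBranchLeadingTermBigImageAt_of_katoComponent`.

Chain (all kernel, no certificate): for `V` with `C • V^{(±p)} = W`, the disjunct `Mult V p` of the
predicate is VACUOUS (`ord_p j(V) = ord_p j(W) ≥ 0` vs `ord_p j < 0` at a multiplicative prime), so
`V` is good ordinary; `K = ℚ(√p*)` is realised as the quadratic subfield of `F = ℚ(ζ_p)`
(`exists_sq_eq_pStar_and_finrank_eq_two`, the quadratic Gauss sum); additive-p1's [C]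
(`SelmerDualData.toChiEigen`: `X(W/ℚ_∞)` IS a dual of `Sel(V/K·ℚ_∞)^{(χ_K)}`) and additive-p2's
eigen-descent + generator normalisation (`SelmerDualData.exists_chiEigenInCyclotomic`: … IS a dual
`D'` of `e_{(p−1)/2}·Sel(V/ℚ(μ_{p^∞}))` at a generator `γ' ∈ Gal(ℚ̄/K·F)`, same characteristic ideal)
feed the fact; its conclusion `ι g = C(u·ϖ)·B_{(p−1)/2}` is read at `T = 0` with additive-p4's
`constantCoeff_padicLFunction[Minus]Branch_half` (`B_{(p−1)/2}(0) = α⁻¹·∑_a (a/p)[a/p]^±_f`) and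
`α ∈ ℤ_p^×` (`unitRoot_spec_holds`). So the gen-6/7 rank-0 consumers of these predicates
(additive-p4's `X4RankZeroTwist.missingUpperBoundAt_of_odd_prime_of_surj`, additive-p2's
`ClassX4Gord.missingUpperBoundAt_rankZero_of_chiBranch`, additive-p1's X4(M) consumers restricted
to a good ordinary twist) hold from [Kato component reading-fact + Delbourgo Prop. 4 + GZK +
modularity] at EVERY odd `p` — see `GordRankZeroKatoComponent.lean`. Reducible (Wuthrich Thm. 16)
twin: `GordChiBranchWuthrichComponent.lean`. The LOWER (Eisenstein) half is untouched; labels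
UNCHANGED; nothing booked.

References: K. Kato, Astérisque 295 (2004) Thm. 17.4 (3), §12.1, §17.3 [Kato2004Asterisque];
R. Greenberg, LNM 1716 (1999) §5 p. 143 [GreenbergLNM1716]; B. Mazur, J. Tate, J. Teitelbaum,
Invent. Math. 84 (1986) §I.13–I.14 [MazurTateTeitelbaum1986Invent].
-/

noncomputable section

open scoped Classical MatrixGroups ModularForm

namespace Summit.BirchSwinnertonDyer.Rank1Residual.Additive

open CongruenceSubgroup WeierstrassCurve Literature.NumberTheory.EllipticCurves
  Literature.NumberTheory.EllipticCurves.ModularForms Literature.NumberTheory.EllipticCurves.Rank1Residual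
  Literature.NumberTheory.GaloisRepresentations Summit.BirchSwinnertonDyer.Rank1Residual.AdditivePotMult

/-! ## §1 The quadratic subfield `ℚ(√p*) ⊆ ℚ(ζ_p)` as a field with a chosen square root -/

section QuadraticSubfield

variable (p : ℕ) [hp : Fact p.Prime] (L : Type) [Field L] [NumberField L] [hcyc : IsCyclotomicExtension {p} ℚ L]

include hcyc in
/-- **`K = ℚ(√p*) ⊆ ℚ(ζ_p)` with its generator**: for `p` odd there is an intermediate field `K`
of `L = ℚ(ζ_p)` of degree `2` containing `θ` with `θ² = p* = (−1)^{(p−1)/2}p` and `θ ∉ ℚ` (the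
quadratic Gauss sum; gen 6's `exists_sq_eq_pStar_and_finrank_eq_two`). [folklore] -/
theorem exists_intermediateField_sq_eq_pStar (hp2 : p ≠ 2) :
    ∃ K : IntermediateField ℚ L, ∃ θ : K, Module.finrank ℚ K = 2 ∧
      θ ∉ Set.range (algebraMap ℚ K) ∧ θ ^ 2 = algebraMap ℚ K ((-1) ^ (p / 2) * p) := by
  obtain ⟨g, hg, hK2⟩ := exists_sq_eq_pStar_and_finrank_eq_two p (L := L) hp2
  refine ⟨IntermediateField.adjoin ℚ {g}, ⟨g, IntermediateField.mem_adjoin_simple_self ℚ g⟩, hK2,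
    ?_, ?_⟩
  · rintro ⟨q, hq⟩
    have hgq : g = algebraMap ℚ L q := by
      have := congrArg (fun x : IntermediateField.adjoin ℚ {g} ↦ (x : L)) hq
      simpa using this.symm
    have hbot : IntermediateField.adjoin ℚ {g} = ⊥ := by
      rw [IntermediateField.adjoin_simple_eq_bot_iff, IntermediateField.mem_bot]
      exact ⟨q, hgq.symm⟩
    have h1 : Module.finrank ℚ (IntermediateField.adjoin ℚ {g}) = 1 := by
      rw [hbot, IntermediateField.finrank_bot]
    omega
  · apply Subtype.ext
    push_cast
    simpa using hg

end QuadraticSubfield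

/-! ## §2 The multiplicative disjunct is vacuous for a potentially good twist -/

section Vacuous

variable {p : ℕ} [hp : Fact p.Prime]

/-- If `W` is potentially good at `p` (`0 ≤ ord_p j(W)`) and `C • V^{(d)} = W` (`d ≠ 0`), then `V`
is NOT multiplicative at `p` (`j` is a twist invariant and `ord_p j < 0` at a multiplicative prime;
Silverman *AEC* VII.5.1(b)). [cite: SilvermanAEC2009, VII.5 Prop. 5.1(b)] -/
theorem not_mult_of_model_twist_of_padicValRat_j_nonneg (W : WeierstrassCurve ℚ) [W.IsElliptic]
    (V : WeierstrassCurve ℚ) [V.IsElliptic] [V.IsGloballyMinimal] {d : ℚ} (hd : d ≠ 0)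
    (hCW : ∃ C : VariableChange ℚ, C • V.quadraticTwist d = W) (hj : 0 ≤ padicValRat p W.j) :
    ¬ Mult V p := fun hmult ↦ by
  have hjV := EisensteinPrimes.padicValRat_j_neg_of_mult V p hmult
  rw [← j_of_model_twist (W := V) hd hCW] at hjV
  exact absurd hj (not_le.mpr hjV)

/-- Hence `GoodOrd V p ∨ Mult V p` gives `IsOrdinaryAt V p` for such `V`. [folklore] -/
theorem isOrdinaryAt_of_goodOrd_or_mult_of_model_twist (W : WeierstrassCurve ℚ) [W.IsElliptic]
    (V : WeierstrassCurve ℚ) [V.IsElliptic] [V.IsGloballyMinimal] {d : ℚ} (hd : d ≠ 0)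
    (hCW : ∃ C : VariableChange ℚ, C • V.quadraticTwist d = W) (hj : 0 ≤ padicValRat p W.j)
    (h : GoodOrd V p ∨ Mult V p) : IsOrdinaryAt V p :=
  h.elim id fun hm ↦ absurd hm (not_mult_of_model_twist_of_padicValRat_j_nonneg W V hd hCW hj)

/-- `quadSign K g • t = if g ∈ galRange K then t else −t`. [folklore] -/
theorem quadSign_smul_eq_ite (K : Type) [Field K] [NumberField K] {A : Type*} [AddCommGroup A]
    (g : Field.absoluteGaloisGroup ℚ) (t : A) :
    quadSign K g • t = if g ∈ galRange (K := ℚ) K then t else -t := by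
  by_cases hg : g ∈ galRange (K := ℚ) K
  · rw [quadSign_of_mem K hg, one_zsmul, if_pos hg]
  · rw [quadSign_of_not_mem K hg, neg_one_zsmul, if_neg hg]

/-- The membership hypothesis `hS` of the component reading-facts, discharged for
`S = chiEigenSelmerIn V K p κ U`. [folklore] -/
theorem mem_chiEigenSelmerIn_iff_ite (V : WeierstrassCurve ℚ) (K : Type) [Field K] [NumberField K]
    (κ : ZpExtension ℚ p) [(galRange (K := ℚ) K).Normal] (U : Subgroup (Field.absoluteGaloisGroup ℚ))
    [U.Normal] (t : V.subgroupH1 p (κ.kerSubgroup ⊓ galRange (K := ℚ) K ⊓ U)) :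
    t ∈ chiEigenSelmerIn V K p κ U ↔
      t ∈ V.selmerGroupOver p (κ.kerSubgroup ⊓ galRange (K := ℚ) K ⊓ U) ∧
        ∀ g ∈ κ.kerSubgroup,
          V.conjH1 p _ g t = if g ∈ galRange (K := ℚ) K then t else -t := by
  rw [mem_chiEigenSelmerIn_iff]
  refine and_congr Iff.rfl ⟨fun h g hg ↦ ?_, fun h g ↦ ?_⟩
  · rw [h ⟨g, hg⟩, quadSign_smul_eq_ite]
  · rw [h g g.2, quadSign_smul_eq_ite]

omit hp in
/-- `p ≡ 3 (mod 4)` ⇒ `p* = −p`. [folklore] -/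
theorem pStar_eq_neg_of_mod_four_eq_three (hp3 : p % 4 = 3) : ((-1 : ℚ) ^ (p / 2) * p) = -(p : ℚ) := by
  have hodd : Odd (p / 2) := ⟨p / 4, by omega⟩
  rw [hodd.neg_one_pow]; ring

omit hp in
/-- `p ≡ 1 (mod 4)` ⇒ `p* = p`. [folklore] -/
theorem pStar_eq_self_of_mod_four_eq_one (hp1 : p % 4 = 1) : ((-1 : ℚ) ^ (p / 2) * p) = (p : ℚ) := by
  have heven : Even (p / 2) := ⟨p / 4, by omega⟩
  rw [heven.neg_one_pow]; ring

/-- A unit of `ℤ_p` and its inverse, cast to `ℚ_p`. [folklore] -/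
theorem coe_units_inv_eq_inv (u : ℤ_[p]ˣ) :
    (((u⁻¹ : ℤ_[p]ˣ) : ℤ_[p]) : ℚ_[p]) = (((u : ℤ_[p]) : ℚ_[p]))⁻¹ := by
  symm
  apply inv_eq_of_mul_eq_one_right
  rw [← PadicInt.coe_mul, Units.mul_inv, PadicInt.coe_one]

end Vacuous

/-! ## §3 `ChiBranchLeadingTermOddBigImageAt W p` from the Kato component fact (`p ≡ 3 (mod 4)`) -/

section OddBigImage

variable (W : WeierstrassCurve ℚ) [W.IsElliptic] (p : ℕ) [hp : Fact p.Prime]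

/-- **Brick 5′, odd branch, big image.** For `W/ℚ` potentially good at `p` (`0 ≤ ord_p j(W)`; e.g.
the (G)-cell), the typed input `ChiBranchLeadingTermOddBigImageAt W p` of additive-p4's line V9b HOLDS,
given the component `i = (p−1)/2` reading of Kato 2004 Thm. 17.4 (3)
(`Kato2004.charIdeal_dvd_padicLFunctionBranch_component_of_surjective`): for every globally minimal
`V`, good ordinary or multiplicative at `p` (the multiplicative case is vacuous), with
`C • V^{(−p)} = W`, `ρ_{V,p^∞}` onto, every cyclotomic `κ/γ` and every `Λ`-dual datum `D` of
`Sel_{p^∞}(W/ℚ_∞)`: `X(W/ℚ_∞)` is `Λ`-torsion and some `g ∈ char_Λ X(W/ℚ_∞)` has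
`g(0) = u·ϖ⁻·∑_a (a/p)[a/p]⁻_f`. Kernel chain: additive-p1's [C] (`toChiEigen`) + additive-p2's
eigen-descent and generator normalisation (`SelmerDualData.exists_chiEigenInCyclotomic`) + the fact
over `ℚ(μ_{p^∞})` + `T = 0` (additive-p4's `constantCoeff_padicLFunctionMinusBranch_half`, MTT §I.14)
+ `α ∈ ℤ_p^×`. [cite: Kato2004Asterisque, Thm. 17.4 (3) (p. 273)]
[cite: GreenbergLNM1716, §5 p. 143] [cite: MazurTateTeitelbaum1986Invent, §I.13–I.14] -/
theorem chiBranchLeadingTermOddBigImageAt_of_katoComponent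
    (hK : Kato2004.charIdeal_dvd_padicLFunctionBranch_component_of_surjective)
    (hj : 0 ≤ padicValRat p W.j) : ChiBranchLeadingTermOddBigImageAt W p := by
  intro V _ _ κ γ N _ f hp3 hCW hred hsurj hκ hγ hcv hf D ϖ hϖ
  have hp2 : p ≠ 2 := by rintro rfl; norm_num at hp3
  have hpne : (-(p : ℚ)) ≠ 0 := neg_ne_zero.mpr (Nat.cast_ne_zero.mpr hp.out.ne_zero)
  have hodd : ¬ Even (p / 2) := by rw [Nat.not_even_iff_odd]; exact ⟨p / 4, by omega⟩
  -- `V` is good ordinary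
  have hord : IsOrdinaryAt V p := isOrdinaryAt_of_goodOrd_or_mult_of_model_twist W V hpne hCW hj hred
  obtain ⟨C, hC⟩ := hCW
  -- the fields `F = ℚ(ζ_p) ⊇ K = ℚ(√−p)`
  haveI hcycL : IsCyclotomicExtension {p} ℚ (CyclotomicField p ℚ) := by
    have h : (CyclotomicField.algebra p ℚ : Algebra ℚ (CyclotomicField p ℚ)) =
        DivisionRing.toRatAlgebra := Subsingleton.elim _ _
    exact h ▸ CyclotomicField.isCyclotomicExtension p ℚ
  obtain ⟨K, θ, hK2, hθ, hθ2⟩ := exists_intermediateField_sq_eq_pStar p (CyclotomicField p ℚ) hp2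
  haveI : NumberField K := NumberField.of_module_finite ℚ K
  have hcK : θ ^ 2 = algebraMap ℚ K (-(p : ℚ)) := by
    rw [hθ2, pStar_eq_neg_of_mod_four_eq_three hp3]
  haveI : IsGalois ℚ K := isGalois_of_finrank_eq_two K hK2
  haveI := normal_galRange K hK2 (sigmaQ_ne_one K hK2 hθ hcK)
  haveI := normal_galRange_cyclotomic p (CyclotomicField p ℚ)
  haveI : (V.quadraticTwist (-(p : ℚ))).IsElliptic := V.isElliptic_quadraticTwist hpne
  -- the `Λ`-dual datum of `e_{(p−1)/2} Sel(V/ℚ(μ_{p^∞}))` at a normalised generator, same `char`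
  obtain ⟨γ', hγ'KF, hκγ', ⟨g₀, hg₀, hγ'eq⟩, D', hchar, htor⟩ :=
    SelmerDualData.exists_chiEigenInCyclotomic p (CyclotomicField p ℚ) V K hK2 hθ hcK κ hC hp2 D
  -- the fact, applied to that datum
  obtain ⟨htorX, g, hgmem, u, hιg⟩ := hK p V K (CyclotomicField p ℚ) (κ := κ) (γ := γ') (f := f)
    (chiEigenSelmerIn V K p κ (galRange (K := ℚ) (CyclotomicField p ℚ)))
    (fun t ht ↦ conjH1_mem_chiEigenSelmerIn γ' ht) D'.X D'.toDual hp2 hK2 ⟨θ, hθ2⟩ hord hsurj hκ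
    (isTopGenerator_of_kappa_eq κ hκγ' hγ)
    (isCyclotomicVariable_of_eq_mul p κ hκ hg₀ hγ'eq hcv)
    (Subgroup.mem_inf.mp hγ'KF).1 (Subgroup.mem_inf.mp hγ'KF).2 hf
    (mem_chiEigenSelmerIn_iff_ite V K κ _) D'.bijective D'.toDual_T_smul D'.toDual_C_smul ϖ
    (by rw [if_neg hodd]; exact hϖ)
  refine ⟨htor.mp htorX, g, hchar ▸ hgmem, ?_⟩
  -- `T = 0`: `g(0) = u ϖ · α⁻¹ ∑ (a/p)[a/p]⁻`
  obtain ⟨-, hunit⟩ := unitRoot_spec_holds V p hord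
  obtain ⟨ua, hua⟩ := hunit
  refine ⟨u * ua⁻¹, ?_⟩
  have h0 := congrArg PowerSeries.constantCoeff hιg
  rw [constantCoeff_iwasawaToPowerSeries, if_neg hodd, map_mul, PowerSeries.constantCoeff_C,
    constantCoeff_padicLFunctionMinusBranch_half p hp2 V hord hf, ← hua] at h0
  rw [h0, Units.val_mul, PadicInt.coe_mul, coe_units_inv_eq_inv]
  ring

end OddBigImage

/-! ## §4 `ChiBranchLeadingTermBigImageAt W p` from the Kato component fact (`p ≡ 1 (mod 4)`) -/

section EvenBigImage

variable (W : WeierstrassCurve ℚ) [W.IsElliptic] (p : ℕ) [hp : Fact p.Prime]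

/-- **Brick 5′, even branch, big image.** For `W/ℚ` potentially good at `p` (`0 ≤ ord_p j(W)`), the
typed input `ChiBranchLeadingTermBigImageAt W p` (`p ≡ 1 (mod 4)`, twist by `p = p*`) HOLDS, given
the component `i = (p−1)/2` reading of Kato 2004 Thm. 17.4 (3): same chain as the odd branch, with
the PLUS branch and additive-p4's `constantCoeff_padicLFunctionBranch_half`
(`B_{(p−1)/2}(0) = α⁻¹·∑_a (a/p)[a/p]⁺_f`). [cite: Kato2004Asterisque, Thm. 17.4 (3) (p. 273)]
[cite: GreenbergLNM1716, §5 p. 143] [cite: MazurTateTeitelbaum1986Invent, §I.13–I.14] -/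
theorem chiBranchLeadingTermBigImageAt_of_katoComponent
    (hK : Kato2004.charIdeal_dvd_padicLFunctionBranch_component_of_surjective)
    (hj : 0 ≤ padicValRat p W.j) : ChiBranchLeadingTermBigImageAt W p := by
  intro V _ _ κ γ N _ f hp1 hCW hred hsurj hκ hγ hcv hf D ϖ hϖ
  have hp2 : p ≠ 2 := by rintro rfl; norm_num at hp1
  have hpne : (p : ℚ) ≠ 0 := Nat.cast_ne_zero.mpr hp.out.ne_zero
  have heven : Even (p / 2) := ⟨p / 4, by omega⟩
  have hord : IsOrdinaryAt V p := isOrdinaryAt_of_goodOrd_or_mult_of_model_twist W V hpne hCW hj hred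
  obtain ⟨C, hC⟩ := hCW
  haveI hcycL : IsCyclotomicExtension {p} ℚ (CyclotomicField p ℚ) := by
    have h : (CyclotomicField.algebra p ℚ : Algebra ℚ (CyclotomicField p ℚ)) =
        DivisionRing.toRatAlgebra := Subsingleton.elim _ _
    exact h ▸ CyclotomicField.isCyclotomicExtension p ℚ
  obtain ⟨K, θ, hK2, hθ, hθ2⟩ := exists_intermediateField_sq_eq_pStar p (CyclotomicField p ℚ) hp2
  haveI : NumberField K := NumberField.of_module_finite ℚ K
  have hcK : θ ^ 2 = algebraMap ℚ K (p : ℚ) := by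
    rw [hθ2, pStar_eq_self_of_mod_four_eq_one hp1]
  haveI : IsGalois ℚ K := isGalois_of_finrank_eq_two K hK2
  haveI := normal_galRange K hK2 (sigmaQ_ne_one K hK2 hθ hcK)
  haveI := normal_galRange_cyclotomic p (CyclotomicField p ℚ)
  haveI : (V.quadraticTwist (p : ℚ)).IsElliptic := V.isElliptic_quadraticTwist hpne
  obtain ⟨γ', hγ'KF, hκγ', ⟨g₀, hg₀, hγ'eq⟩, D', hchar, htor⟩ :=
    SelmerDualData.exists_chiEigenInCyclotomic p (CyclotomicField p ℚ) V K hK2 hθ hcK κ hC hp2 D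
  obtain ⟨htorX, g, hgmem, u, hιg⟩ := hK p V K (CyclotomicField p ℚ) (κ := κ) (γ := γ') (f := f)
    (chiEigenSelmerIn V K p κ (galRange (K := ℚ) (CyclotomicField p ℚ)))
    (fun t ht ↦ conjH1_mem_chiEigenSelmerIn γ' ht) D'.X D'.toDual hp2 hK2 ⟨θ, hθ2⟩ hord hsurj hκ
    (isTopGenerator_of_kappa_eq κ hκγ' hγ)
    (isCyclotomicVariable_of_eq_mul p κ hκ hg₀ hγ'eq hcv)
    (Subgroup.mem_inf.mp hγ'KF).1 (Subgroup.mem_inf.mp hγ'KF).2 hf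
    (mem_chiEigenSelmerIn_iff_ite V K κ _) D'.bijective D'.toDual_T_smul D'.toDual_C_smul ϖ
    (by rw [if_pos heven]; exact hϖ)
  refine ⟨htor.mp htorX, g, hchar ▸ hgmem, ?_⟩
  obtain ⟨-, hunit⟩ := unitRoot_spec_holds V p hord
  obtain ⟨ua, hua⟩ := hunit
  refine ⟨u * ua⁻¹, ?_⟩
  have h0 := congrArg PowerSeries.constantCoeff hιg
  rw [constantCoeff_iwasawaToPowerSeries, if_pos heven, map_mul, PowerSeries.constantCoeff_C,
    constantCoeff_padicLFunctionBranch_half p hp2 V hord hf, ← hua] at h0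
  rw [h0, Units.val_mul, PadicInt.coe_mul, coe_units_inv_eq_inv]
  ring

end EvenBigImage

/-! ## §5 On the (G)-cell -/

section Gord

variable (W : WeierstrassCurve ℚ) [W.IsElliptic] (p : ℕ) [hp : Fact p.Prime]

/-- **On the (G)-cell** (Delbourgo's (G), `TypeG W p`, in particular on X3♯(G-ord)/X4♯(G-ord))
both big-image branch inputs hold, given the Kato component fact (`ord_p j ≥ 0` by gen 2's
`padicValRat_j_nonneg_of_typeG`). [cite: Kato2004Asterisque, Thm. 17.4 (3) (p. 273)] -/
theorem TypeG.chiBranchLeadingTermBigImageAt_and_odd_of_katoComponent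
    (hK : Kato2004.charIdeal_dvd_padicLFunctionBranch_component_of_surjective) (hG : TypeG W p) :
    ChiBranchLeadingTermBigImageAt W p ∧ ChiBranchLeadingTermOddBigImageAt W p :=
  ⟨chiBranchLeadingTermBigImageAt_of_katoComponent W p hK (padicValRat_j_nonneg_of_typeG W p hG),
    chiBranchLeadingTermOddBigImageAt_of_katoComponent W p hK (padicValRat_j_nonneg_of_typeG W p hG)⟩

end Gord

end Summit.BirchSwinnertonDyer.Rank1Residual.Additive

end
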